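import Summits.BirchSwinnertonDyer.BirchSwinnertonDyer.Theorems.PrintCFramBottomClassIndexLawFiveLeClassGroupChiRealisation
import Summits.BirchSwinnertonDyer.BirchSwinnertonDyer.Theorems.PrintCFramBottomClassIndexLawFiveLeLevelDictionaryBetaSource
import Summits.BirchSwinnertonDyer.BirchSwinnertonDyer.Theorems.PrintCFramBottomClassIndexLawFiveLeLevelDictionaryDescent
import Summits.BirchSwinnertonDyer.BirchSwinnertonDyer.Theorems.PrintCFramBottomClassIndexLawFiveLeSelmerCountLevelZero
import HarnessLib

/-!
# Route `PrintCFram`, crux C2 `BottomClassIndexLawFiveLe` (stmt-BirchSwinnertonDyer-20372), line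
# `eisenstein-resource-bdp-line` (registry v24, arithmetic pair B1-level / B1-sha⁰): **LEVEL 0 ∧ «THE STABLE LINE'S OWN CLASS-GROUP
# COMPONENT IS NON-TRIVIAL» ⟹ `Ш(W)[p] ≠ 0` — PARITY-FREE, MODEL-FREE, KUMMER-FREE** (cell `bsd-print-cfram`, width seat
# `bsd-line-cfram-p1-w2` g12; helper `--supports` 20372; 0 defs, 0 facts, 0 sorry; UNCONDITIONAL — no named fact is used)

HONEST FRAMING. Nothing about BSD is proved here and no stub is closed; B1-level / B1-sha⁰ stay OPEN (promote). The census of the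
level-0 members so far reads: w4 g10 «θ_e-REGULAR ⟹ `Ш(W)[p] = 0`» (model-free, mod CT+GZK); w2 g11 p687909 §3 «LEVEL 0 ∧ θ_e-IRREGULAR
⟹ `Ш(W)[p] ≠ 0`» for the model `W_ψ` WHOSE STABLE LINE `Φ = W[𝔭]` IS ODD (Kummer theory over `K′ ∋ ζ_p`, two characters, `#R_rel ≥ p²`,
`[R_rel : R_str] ≤ p`); w5 g3 (β) «class factor non-unit ⟹ level ≥ 1 ∨ `Ш ≠ 0` ∨ TRANSVERSE» (mod MW). The `p`-isogenous twin
`W_ψ/Φ` (stable line EVEN, character `θ_e`; w5 g3's TRANSVERSE case) was not covered at level 0. THIS FILE proves ONE statement covering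
both models: for a rank-one CM-ramified member with a LEVEL-0 generator and stable line `Φ` acted on through `θ` (ANY parity), if the
`θ̃`-component of the `p`-class group of an abelian realisation field `L` of `θ` (`p ∤ [L:ℚ]`) is non-trivial, then `Ш(W/ℚ)[p] ≠ 0`.
For the EVEN-line twin this is «LEVEL 0 ∧ θ_e-IRREGULAR ⟹ `Ш ≠ 0`» (new); for the ODD-line model the hypothesis `#e_{ψ̃}(ℤ_p⊗Cl) ≠ 1`
is Mazur–Wiles off the Kriz–Li locus, recovering (β) at level 0 by a shorter road.

THE ARGUMENT (all inputs tree theorems). (1) `e_{θ̃}(ℤ_p ⊗ Cl L) ≠ 0` ⟹ a non-zero EVERYWHERE-UNRAMIFIED `θ`-eigen character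
`κ : Γ_L → 𝔽_p` (Hilbert class field; w6 g2 `HerbrandOddClassGroup.exists_absGaloisHom_ne_one_of_chiComponent_ne_bot`, unconditional);
(2) transport to `res(Γ_L) ≤ Γ_ℚ` (w5 g3 `LevelDictionaryBeta.exists_addHom_on_range_of_absGaloisHom`) and inflate through the
`p′`-index normal subgroup `res(Γ_L)` (w4 g8's LINK `LevelDictionary.exists_unramified_class_of_hom_of_le_ker`): a non-zero class
`c ∈ H¹(ℚ, Φ)` which is a coboundary on EVERY inertia group; (3) **STRICTNESS IS AUTOMATIC**: `Φ^{I_𝔓} = 0` for `𝔓 ∣ p` (the inertia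
homothety of the class, `LevelDictionaryAlpha.sub_eq_zero_of_forall_inertia_smul_eq_at_p`), and a cocycle that is a coboundary on a
subgroup `I` with `Φ^I = 0`, `I` normalised by `D`, is a coboundary on `D` (§2, inflation–restriction by hand) — so `c` is trivial on
the decomposition group `D_v`; (4) `c` has order `p`, so `p ≤ #(R_rel(Φ) ⊓ ker res_{D_v})`, and w2 g11's LEVEL-0 injection
`SelmerCount.exists_sha_ne_zero_of_level_zero_of_prime_le_strict_of_cmRamified` (p686891, no named fact) gives `Ш(W)[p] ≠ 0`.

* §1 `exists_unramified_class_of_classGroupChiCard_ne_one` — generic `Γ_ℚ`-module `A` of order `p` with character `θ`: the `H¹` source.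
* §2 `exists_principal_on_of_principal_on_subgroup` — the cocycle lemma of (3).
* §3 **`exists_sha_ne_zero_of_level_zero_of_lineClassGroupChiCard_ne_one`** (realisation `L` abelian) and
  **`…_ne_one_at`** (irregularity read at ANY Galois realisation of degree prime to `p`, via this seat's realisation independence).

THEOREMS ONLY; no definition, no named fact, no `sorry`. BSD is not proved by any of this; no summit statement is proved by this seat.
References: [NeukirchANT1999] Ch. VI §7 Thm. (7.1) (Hilbert class field), Ch. I §9; [SerreGaloisCohomology1997] I.§2.6 (b), I.§5.1;
[SilvermanAEC2009] X.§4; [Washington1997] §6.3, §10.2.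
-/

set_option autoImplicit false
-- `…BirchSwinnertonDyer.BirchSwinnertonDyer.Theorems…` is the problem's mandated namespace (D-0017).
set_option linter.dupNamespace false

noncomputable section

open scoped Classical Pointwise

namespace Summit.BirchSwinnertonDyer.BirchSwinnertonDyer.Theorems.PrintCFram.SelmerCount

open NumberField IsDedekindDomain Field WeierstrassCurve
open Literature.NumberTheory.NumberFields Literature.NumberTheory.EllipticCurves Literature.NumberTheory.GaloisRepresentations
  Literature.NumberTheory.EllipticCurves.Rank1Residual Literature.NumberTheory.EllipticCurves.GreenbergSelmer
open Summit.BirchSwinnertonDyer.Rank1Residual.X2.ResidualDevissageModules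
open Summit.BirchSwinnertonDyer.BirchSwinnertonDyer.Theorems.PrintCFram.ClassGroupChiTower

variable {p : ℕ} [hp : Fact p.Prime]

/-! ## §1 The `H¹` source: a non-trivial `θ̃`-component gives a non-zero everywhere-unramified class -/

section Source

variable {A : Type} [AddCommGroup A] [DistribMulAction (absoluteGaloisGroup ℚ) A] [TopologicalSpace A] [DiscreteTopology A]

/-- **A NON-TRIVIAL `θ̃`-COMPONENT OF THE `p`-CLASS GROUP GIVES A NON-ZERO EVERYWHERE-UNRAMIFIED CLASS OF `H¹(ℚ, A)`** (any parity,
no Mazur–Wiles). `A` a discrete `Γ_ℚ`-module of prime order `p` with continuous orbit maps, acted on through `θ : Γ_ℚ →* 𝔽_pˣ`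
(`g • a = θ(g)·a`, `θ g = 1 ↔ g` acts trivially); `L/ℚ` abelian with `p ∤ [L:ℚ]` and `θ(res Γ_L) = 1`; `θ̃ : Gal(L/ℚ) →* ℤ_pˣ` a lift of
`θ` (`θ̃(τ̄) mod p = θ τ`). IF `#e_{θ̃}(ℤ_p ⊗ Cl L) ≠ 1` THEN there is a continuous crossed homomorphism `w : Γ_ℚ → A` with non-zero class
which is a coboundary on the inertia group of every prime of `\bar ℤ`. (w6 g2's Hilbert-class-field character ⟶ w5 g3's transport ⟶
w4 g8's inflation link through `res(Γ_L)`, of index `[L:ℚ]` prime to `p`.) [cite: NeukirchANT1999, Ch. VI §7 Thm. (7.1)]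
[cite: SerreGaloisCohomology1997, I.§2.6 (b) and I.§5.1] [cite: Washington1997, §6.3] -/
theorem exists_unramified_class_of_classGroupChiCard_ne_one (hcard : Nat.card A = p)
    (hcont : ∀ a : A, Continuous fun g : absoluteGaloisGroup ℚ ↦ g • a)
    (θ : absoluteGaloisGroup ℚ →* (ZMod p)ˣ)
    (hθ : ∀ (g : absoluteGaloisGroup ℚ) (a : A), g • a = (((θ g : ZMod p).val : ℕ) : ℤ) • a)
    (hker : ∀ g : absoluteGaloisGroup ℚ, θ g = 1 ↔ ∀ a : A, g • a = a)
    (L : Type) [Field L] [NumberField L] [IsAbelianGalois ℚ L] (hpL : ¬ p ∣ Module.finrank ℚ L)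
    (hrL : ∀ σ : absoluteGaloisGroup L, θ (absGaloisRestrict ℚ L σ) = 1)
    (θt : (L ≃ₐ[ℚ] L) →* ℤ_[p]ˣ)
    (hθt : ∀ τ : absoluteGaloisGroup ℚ, PadicInt.toZMod ((θt (absGaloisQuot ℚ L τ) : ℤ_[p]ˣ) : ℤ_[p]) = ((θ τ : (ZMod p)ˣ) : ZMod p))
    (hne : classGroupChiCard ℚ L p (fun g => ((θt g : ℤ_[p]ˣ) : ℤ_[p])) ≠ 1) :
    ∃ w : contOneCocycles (discreteTopRep (absoluteGaloisGroup ℚ) A),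
      oneCocycleClass _ w ≠ 0 ∧
      ∀ (v : HeightOneSpectrum (𝓞 ℚ)) (𝔓 : Ideal (absIntegers (𝓞 ℚ) ℚ)), 𝔓 ∈ v.primesAbove →
        ∃ a : A, ∀ g ∈ 𝔓.inertia (absoluteGaloisGroup ℚ), w.1 g = g • a - a := by
  haveI : IsGalois ℚ L := IsAbelianGalois.toIsGalois
  haveI : NeZero p := ⟨hp.out.ne_zero⟩
  -- the descent `θ̄` of `θ` to `Gal(L/ℚ)` and its compatibility with `θ̃`
  obtain ⟨θd, hθd⟩ := HerbrandOddClassGroup.exists_factor_absGaloisQuot ℚ L θ hrL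
  have hred : ∀ σ : L ≃ₐ[ℚ] L, PadicInt.toZMod ((θt σ : ℤ_[p]ˣ) : ℤ_[p]) = ((θd σ : (ZMod p)ˣ) : ZMod p) := fun σ => by
    obtain ⟨τ, rfl⟩ := absGaloisQuot_surjective ℚ L σ
    rw [hθt τ, hθd τ]
  -- the component is non-trivial
  have hne' : classGroupChiComponent ℚ L p (fun g => ((θt g : ℤ_[p]ˣ) : ℤ_[p])) ≠ ⊥ := by
    intro h
    apply hne
    rw [classGroupChiCard, h]
    exact Nat.card_unique
  -- (1) the everywhere-unramified `θ`-eigen character of `Γ_L` (Hilbert class field)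
  obtain ⟨κ, hκ1, hopen, hinert, heigen⟩ :=
    HerbrandOddClassGroup.exists_absGaloisHom_ne_one_of_chiComponent_ne_bot hpL θt θd hred θ (fun γ => (hθd γ).symm) hne'
  -- (2) transport to `res(Γ_L)`
  obtain ⟨G, hGc, hGadd, hGconj, hGI, hGne⟩ := LevelDictionaryBeta.exists_addHom_on_range_of_absGaloisHom θ κ hκ1 hopen hinert heigen
  -- the subgroup `N' = res(Γ_L)`: open, normal, of index `[L:ℚ]` prime to `p`, acting trivially on `A`
  set N' : Subgroup (absoluteGaloisGroup ℚ) := (absGaloisRestrict ℚ L).range with hN'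
  haveI : N'.Normal := normal_range_absGaloisRestrict ℚ L
  have hopenN : IsOpen (N' : Set (absoluteGaloisGroup ℚ)) := isOpen_range_absGaloisRestrict ℚ L
  have hN'le : N' ≤ (MulAction.toPermHom (absoluteGaloisGroup ℚ) A).ker := by
    rintro _ ⟨σ, rfl⟩
    rw [HerbrandLineRestriction.mem_ker_toPermHom_iff]
    exact (hker _).mp (hrL σ)
  have hidx : N'.index = Module.finrank ℚ L := by
    have hkq : (absGaloisQuot ℚ L).ker = N' := by
      ext τ
      rw [MonoidHom.mem_ker]
      exact absGaloisQuot_eq_one_iff ℚ L τ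
    rw [← hkq, Subgroup.index_ker, MonoidHom.range_eq_top.2 (absGaloisQuot_surjective ℚ L), Subgroup.card_top]
    exact IsGalois.card_aut_eq_finrank ℚ L
  have hidx0 : N'.index ≠ 0 := by rw [hidx]; exact Module.finrank_pos.ne'
  have hcop : Nat.Coprime N'.index p := by
    rw [hidx, Nat.coprime_comm]
    exact (Nat.Prime.coprime_iff_not_dvd hp.out).2 hpL
  -- `A`-valued version of `G` (`e : A ≃+ ℤ/p`)
  haveI : IsAddCyclic A := isAddCyclic_of_prime_card hcard
  let e : A ≃+ ZMod p := addEquivOfAddCyclicCardEq (by rw [hcard, Nat.card_zmod])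
  -- (2') the inflation link through `N'`
  obtain ⟨w, hw, -, hwI⟩ := LevelDictionary.exists_unramified_class_of_hom_of_le_ker (K := ℚ) hcard hcont N' hopenN hN'le hidx0 hcop
    (fun g => e.symm (G g)) (continuous_of_discreteTopology.comp hGc)
    (fun a ha b hb => by rw [hGadd a ha b hb, map_add])
    (fun g m hm => by
      apply e.injective
      rw [e.apply_symm_apply, hGconj g m hm, hθ g, map_zsmul, e.apply_symm_apply, zsmul_eq_mul, Int.cast_natCast,
        ZMod.natCast_zmod_val])
    (fun ℓ 𝔓 h𝔓 m hm hmI => by rw [hGI ℓ 𝔓 h𝔓 m hm hmI, map_zero])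
    (by
      obtain ⟨m, hm, hGm⟩ := hGne
      exact ⟨m, hm, fun h => hGm (e.symm.map_eq_zero_iff.1 h)⟩)
  exact ⟨w, hw, hwI⟩

end Source

/-! ## §2 A cocycle principal on `I` with `M^I = 0`, `I` normalised by `D`, is principal on `D` -/

section Cocycle

variable {G : Type} [Group G] [TopologicalSpace G]
  {M : Type} [AddCommGroup M] [DistribMulAction G M] [TopologicalSpace M] [DiscreteTopology M]

/-- **Inflation–restriction by hand.** Let `w : G → M` be a continuous crossed homomorphism, `I, D ≤ G` with `I` normalised by `D`
(`d i d⁻¹ ∈ I` for `d ∈ D`, `i ∈ I`) and `M^I = 0`. If `w` is principal on `I` (`w(i) = i•a − a`), then `w` is principal on `D` with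
the SAME `a`: for `d ∈ D` the element `m = w(d) − (d•a − a)` is fixed by `I` (expand `w(i·d) = w(d·(d⁻¹ i d))` both ways), hence `0`.
(`H¹(D/I, M^I) = 0 → H¹(D, M) ↪ H¹(I, M)`.) [cite: SerreGaloisCohomology1997, I.§2.6 (b)] -/
theorem exists_principal_on_of_principal_on_subgroup (w : contOneCocycles (discreteTopRep G M)) (I D : Subgroup G)
    (hconj : ∀ d ∈ D, ∀ i ∈ I, d * i * d⁻¹ ∈ I) (hMI : ∀ m : M, (∀ i ∈ I, i • m = m) → m = 0)
    {a : M} (ha : ∀ i ∈ I, w.1 i = i • a - a) :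
    ∀ d ∈ D, w.1 d = d • a - a := by
  intro d hd
  have hcoc : ∀ g h : G, w.1 (g * h) = w.1 g + g • w.1 h := fun g h => w.2 g h
  -- `m = w d - (d • a - a)` is `I`-fixed
  have hfix : ∀ i ∈ I, i • (w.1 d - (d • a - a)) = w.1 d - (d • a - a) := by
    intro i hi
    have hj : d⁻¹ * i * d ∈ I := by
      have := hconj d⁻¹ (D.inv_mem hd) i hi
      rwa [inv_inv] at this
    -- `w (i d)` computed two ways
    have h1 : w.1 (i * d) = (i • a - a) + i • w.1 d := by rw [hcoc, ha i hi]
    have h2 : w.1 (i * d) = w.1 d + (i * d) • a - d • a := by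
      have e1 : i * d = d * (d⁻¹ * i * d) := by group
      rw [e1, hcoc, ha _ hj, smul_sub, ← mul_smul, ← e1]
      abel
    have h3 : i • w.1 d = w.1 d + (i * d) • a - d • a - (i • a - a) := eq_sub_of_add_eq' (h1.symm.trans h2)
    rw [smul_sub, smul_sub, h3, ← mul_smul]
    abel
  have h0 := hMI _ hfix
  rwa [sub_eq_zero] at h0

end Cocycle

/-! ## §3 On the class: LEVEL 0 ∧ non-trivial component FOR THE LINE'S OWN CHARACTER ⟹ `Ш(W)[p] ≠ 0` -/

section Class

variable (W : WeierstrassCurve ℚ) [W.IsElliptic] [W.IsGloballyMinimal]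

/-- **LEVEL 0 ∧ `#e_{θ̃}(ℤ_p ⊗ Cl L) ≠ 1` ⟹ `Ш(W/ℚ)[p] ≠ 0`, FOR THE CHARACTER `θ` OF THE STABLE LINE ITSELF — ANY PARITY.** `W/ℚ` globally
minimal with CM, `p ≥ 5` CM-ramified, `v ∋ p`; `Φ ≤ W[p]` a `Γ_ℚ`-stable line of order `p` acted on through `θ` (`g • s = θ(g)·s`,
`θ g = 1 ↔ g` acts trivially on `Φ`); `P` a generator of `W(ℚ)` modulo torsion of LEVEL `0` (`p • Q ≠ ι_p P` in `W(ℚ_p)`); `L/ℚ` abelian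
with `p ∤ [L:ℚ]`, `θ(res Γ_L) = 1`, `θ̃ : Gal(L/ℚ) →* ℤ_pˣ` lifting `θ`. IF `#e_{θ̃}(ℤ_p ⊗ Cl L) ≠ 1` THEN `∃ c ∈ Ш(W/ℚ), c ≠ 0 ∧ p • c = 0`.
For the EVEN-line twin (`θ = θ_e`) this is «LEVEL 0 ∧ θ_e-IRREGULAR ⟹ `Ш ≠ 0`»; for the ODD-line model (`θ` realises `ψ`) the hypothesis
is Mazur–Wiles' `#e_{ψ̃} = p^{v_p(B_{1,ψ⁻¹})} ≠ 1` off the Kriz–Li locus. UNCONDITIONAL (no named fact): §1 + §2 (strictness at `p` from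
`Φ^{I_𝔓} = 0`) + w2 g11's level-0 injection `exists_sha_ne_zero_of_level_zero_of_prime_le_strict_of_cmRamified`.
[cite: SilvermanAEC2009, X.§4] [cite: NeukirchANT1999, Ch. VI §7 Thm. (7.1), Ch. I §9] [cite: SerreGaloisCohomology1997, I.§2.6 (b)] -/
theorem exists_sha_ne_zero_of_level_zero_of_lineClassGroupChiCard_ne_one
    (hCM : W.HasCM) (hram : CMRamified W p) (h5 : 5 ≤ p)
    {v : HeightOneSpectrum (𝓞 ℚ)} (hpv : ((p : ℕ) : 𝓞 ℚ) ∈ v.asIdeal)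
    (Φ : StableSubgroup (absoluteGaloisGroup ℚ) (geomTorsion W (p : ℤ))) (hcard : Nat.card Φ.Sub = p)
    (P : W.toAffine.Point)
    (hgen : ∀ R : W.toAffine.Point, ∃ (k : ℤ) (T : W.toAffine.Point), IsOfFinAddOrder T ∧ R = k • P + T)
    (hlev : ∀ Q : (W.baseChange ℚ_[p]).toAffine.Point, p • Q ≠ W.toPadicPoint p P)
    (θ : absoluteGaloisGroup ℚ →* (ZMod p)ˣ)
    (hθ : ∀ (g : absoluteGaloisGroup ℚ) (s : Φ.Sub), g • s = (((θ g : ZMod p).val : ℕ) : ℤ) • s)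
    (hker : ∀ g : absoluteGaloisGroup ℚ, θ g = 1 ↔ ∀ s : Φ.Sub, g • s = s)
    (L : Type) [Field L] [NumberField L] [IsAbelianGalois ℚ L] (hpL : ¬ p ∣ Module.finrank ℚ L)
    (hrL : ∀ σ : absoluteGaloisGroup L, θ (absGaloisRestrict ℚ L σ) = 1)
    (θt : (L ≃ₐ[ℚ] L) →* ℤ_[p]ˣ)
    (hθt : ∀ τ : absoluteGaloisGroup ℚ, PadicInt.toZMod ((θt (absGaloisQuot ℚ L τ) : ℤ_[p]ˣ) : ℤ_[p]) = ((θ τ : (ZMod p)ˣ) : ZMod p))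
    (hne : classGroupChiCard ℚ L p (fun g => ((θt g : ℤ_[p]ˣ) : ℤ_[p])) ≠ 1) :
    ∃ c ∈ W.sha, c ≠ 0 ∧ p • c = 0 := by
  have hpr : p.Prime := hp.out
  have hp0 : ((p : ℕ) : ℤ) ≠ 0 := by exact_mod_cast hpr.ne_zero
  have hcont : ∀ s : Φ.Sub, Continuous fun g : absoluteGaloisGroup ℚ ↦ g • s :=
    Φ.continuous_smul_sub (LevelDictionary.continuous_smul_geomTorsion W (p : ℤ))
  -- (1)+(2) a non-zero everywhere-unramified class
  obtain ⟨w, hw0, hwI⟩ := exists_unramified_class_of_classGroupChiCard_ne_one hcard hcont θ hθ hker L hpL hrL θt hθt hne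
  set Sp : Set (HeightOneSpectrum (𝓞 ℚ)) := {v' : HeightOneSpectrum (𝓞 ℚ) | ((p : ℕ) : 𝓞 ℚ) ∈ v'.asIdeal} with hSp
  set c := oneCocycleClass (discreteTopRep (absoluteGaloisGroup ℚ) Φ.Sub) w with hc
  -- unramified outside `p` (indeed everywhere)
  have hunr : c ∈ h1Unramified Φ.Sub Sp := by
    rw [mem_h1Unramified_iff]
    intro v' _ 𝔓 h𝔓
    change c ∈ subgroupResKer Φ.Sub (𝔓.inertia (absoluteGaloisGroup ℚ))
    rw [hc, oneCocycleClass_mem_subgroupResKer_iff]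
    obtain ⟨a, ha⟩ := hwI v' 𝔓 h𝔓
    exact ⟨a, fun σ => ha σ σ.2⟩
  -- (3) strict at `p`: principal on the inertia group of `𝔓₀ ∣ v`, `Φ^{I_𝔓₀} = 0`, hence principal on `D_v = D_{𝔓₀}`
  have hstr : c ∈ subgroupResKer Φ.Sub (decomp v) := by
    obtain ⟨a, ha⟩ := hwI v (adicCompletionPrime ℚ v) (adicCompletionPrime_mem_primesAbove ℚ v)
    rw [hc, oneCocycleClass_mem_subgroupResKer_iff]
    have hconj : ∀ d ∈ (adicCompletionPrime ℚ v).decompositionSubgroup (absoluteGaloisGroup ℚ),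
        ∀ i ∈ (adicCompletionPrime ℚ v).inertia (absoluteGaloisGroup ℚ),
          d * i * d⁻¹ ∈ (adicCompletionPrime ℚ v).inertia (absoluteGaloisGroup ℚ) := fun d hd i hi => by
      have hd' : d • adicCompletionPrime ℚ v = adicCompletionPrime ℚ v := (Ideal.mem_decompositionSubgroup_iff).mp hd
      have h := (Ideal.conj_mem_inertia_smul_iff (adicCompletionPrime ℚ v) d i).mpr hi
      rwa [hd'] at h
    refine ⟨a, fun τ => ?_⟩
    have hτ' : (τ : absoluteGaloisGroup ℚ) ∈ (adicCompletionPrime ℚ v).decompositionSubgroup (absoluteGaloisGroup ℚ) := by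
      rw [decompositionSubgroup_adicCompletionPrime_eq_range]; exact τ.2
    exact exists_principal_on_of_principal_on_subgroup w ((adicCompletionPrime ℚ v).inertia (absoluteGaloisGroup ℚ))
      ((adicCompletionPrime ℚ v).decompositionSubgroup (absoluteGaloisGroup ℚ)) hconj
      (fun m hm => LevelDictionaryAlpha.sub_eq_zero_of_forall_inertia_smul_eq_at_p W Φ hCM h5 hram hcard hpv
        (adicCompletionPrime_mem_primesAbove ℚ v) m hm) ha τ hτ'
  -- (4) `c ≠ 0` has order `p`, so `p ≤ #(R_rel ⊓ ker res_{D_v})`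
  have hSpfin : Sp.Finite := by
    convert finite_setOf_intCast_mem_asIdeal (K := ℚ) hp0 using 1
    ext v'
    simp only [hSp, Set.mem_setOf_eq, Int.cast_natCast]
  haveI : Finite Φ.Sub := Nat.finite_of_card_ne_zero (by rw [hcard]; exact hpr.ne_zero)
  haveI hfin : Finite ↥(h1Unramified Φ.Sub Sp) := finite_h1Unramified_of_continuous Φ.Sub hcont hSpfin
  haveI : Finite ↥(h1Unramified Φ.Sub Sp ⊓ subgroupResKer Φ.Sub (decomp v)) :=
    Finite.of_injective _ (AddSubgroup.inclusion_injective inf_le_left)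
  have hmem : c ∈ h1Unramified Φ.Sub Sp ⊓ subgroupResKer Φ.Sub (decomp v) := ⟨hunr, hstr⟩
  have hc0 : c ≠ 0 := by rw [hc]; exact hw0
  have hpw : p • w = 0 := by
    refine Subtype.ext (ContinuousMap.ext fun g => ?_)
    change p • w.1 g = 0
    exact HerbrandLineRestriction.prime_nsmul_eq_zero_of_card_prime hcard _
  have hpc : p • c = 0 := by
    rw [hc, ← oneCocycleClassₗ_apply, ← map_nsmul, hpw, map_zero]
  have hle : p ≤ Nat.card ↥(h1Unramified Φ.Sub Sp ⊓ subgroupResKer Φ.Sub (decomp v)) := by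
    set x : ↥(h1Unramified Φ.Sub Sp ⊓ subgroupResKer Φ.Sub (decomp v)) := ⟨c, hmem⟩ with hx
    have hx0 : x ≠ 0 := fun h => hc0 (congrArg Subtype.val h)
    have hpx : p • x = 0 := Subtype.ext hpc
    have hord : addOrderOf x = p := by
      have hdvd : addOrderOf x ∣ p := addOrderOf_dvd_of_nsmul_eq_zero hpx
      rcases (Nat.dvd_prime hpr).mp hdvd with h1 | hpeq
      · exact absurd (AddMonoid.addOrderOf_eq_one_iff.mp h1) hx0
      · exact hpeq
    have hdvd := addOrderOf_dvd_natCard x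
    rw [hord] at hdvd
    exact Nat.le_of_dvd Nat.card_pos hdvd
  exact exists_sha_ne_zero_of_level_zero_of_prime_le_strict_of_cmRamified W hCM hram h5 hpv Φ hcard P hgen hlev hle

/-- **The same, with the irregularity read at ANY Galois realisation of degree prime to `p`** (this seat's realisation independence
`ClassGroupChiTower.classGroupChiCard_eq_of_absGaloisQuot_eq`): hypotheses as in
`exists_sha_ne_zero_of_level_zero_of_lineClassGroupChiCard_ne_one`, except that `#e ≠ 1` is supplied for a character `χ₂` of some number
field `K₂` Galois over `ℚ` with `p ∤ [K₂:ℚ]` having the same values on `Γ_ℚ` as `θ̃` (e.g. the CM reflection field, or any field of a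
certificate computation). [cite: SilvermanAEC2009, X.§4] [cite: Lang1990, Ch. 13 §3 Lemma 1 (PDF p. 201)] -/
theorem exists_sha_ne_zero_of_level_zero_of_lineClassGroupChiCard_ne_one_at
    (hCM : W.HasCM) (hram : CMRamified W p) (h5 : 5 ≤ p)
    {v : HeightOneSpectrum (𝓞 ℚ)} (hpv : ((p : ℕ) : 𝓞 ℚ) ∈ v.asIdeal)
    (Φ : StableSubgroup (absoluteGaloisGroup ℚ) (geomTorsion W (p : ℤ))) (hcard : Nat.card Φ.Sub = p)
    (P : W.toAffine.Point)
    (hgen : ∀ R : W.toAffine.Point, ∃ (k : ℤ) (T : W.toAffine.Point), IsOfFinAddOrder T ∧ R = k • P + T)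
    (hlev : ∀ Q : (W.baseChange ℚ_[p]).toAffine.Point, p • Q ≠ W.toPadicPoint p P)
    (θ : absoluteGaloisGroup ℚ →* (ZMod p)ˣ)
    (hθ : ∀ (g : absoluteGaloisGroup ℚ) (s : Φ.Sub), g • s = (((θ g : ZMod p).val : ℕ) : ℤ) • s)
    (hker : ∀ g : absoluteGaloisGroup ℚ, θ g = 1 ↔ ∀ s : Φ.Sub, g • s = s)
    (L : Type) [Field L] [NumberField L] [IsAbelianGalois ℚ L] (hpL : ¬ p ∣ Module.finrank ℚ L)
    (hrL : ∀ σ : absoluteGaloisGroup L, θ (absGaloisRestrict ℚ L σ) = 1)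
    (θt : (L ≃ₐ[ℚ] L) →* ℤ_[p]ˣ)
    (hθt : ∀ τ : absoluteGaloisGroup ℚ, PadicInt.toZMod ((θt (absGaloisQuot ℚ L τ) : ℤ_[p]ˣ) : ℤ_[p]) = ((θ τ : (ZMod p)ˣ) : ZMod p))
    (K₂ : Type) [Field K₂] [NumberField K₂] [IsGalois ℚ K₂] (hp₂ : ¬ p ∣ Module.finrank ℚ K₂) (χ₂ : (K₂ ≃ₐ[ℚ] K₂) →* ℤ_[p]ˣ)
    (hχ₂ : ∀ τ : absoluteGaloisGroup ℚ, χ₂ (absGaloisQuot ℚ K₂ τ) = θt (absGaloisQuot ℚ L τ))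
    (hne₂ : classGroupChiCard ℚ K₂ p (fun g => ((χ₂ g : ℤ_[p]ˣ) : ℤ_[p])) ≠ 1) :
    ∃ c ∈ W.sha, c ≠ 0 ∧ p • c = 0 := by
  haveI : IsGalois ℚ L := IsAbelianGalois.toIsGalois
  have hne : classGroupChiCard ℚ L p (fun g => ((θt g : ℤ_[p]ˣ) : ℤ_[p])) ≠ 1 := by
    rwa [← classGroupChiCard_eq_of_absGaloisQuot_eq p K₂ L hp₂ hpL χ₂ θt hχ₂]
  exact exists_sha_ne_zero_of_level_zero_of_lineClassGroupChiCard_ne_one W hCM hram h5 hpv Φ hcard P hgen hlev θ hθ hker L hpL hrL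
    θt hθt hne

end Class

end Summit.BirchSwinnertonDyer.BirchSwinnertonDyer.Theorems.PrintCFram.SelmerCount

end
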